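import Mathlib

/-!
# `MatrixDescartes` census — rank-one `(2,K)₁`: the SANDWICH LAW for the window profile
# (at its critical point the profile is an explicit convex combination of the two-letter minima: `max_j gⱼ ≤ M = Σⱼ λⱼ^{θⱼ} gⱼ ≤ Σⱼ gⱼ`)

HONEST FRAMING.  Object-search cell `pub-symmetroid`, seat `val-sym-mdr-p1` (generation 21); helper file `--supports` the crux item
stmt-ValiantsHypothesis-18050 (`Theses.LacunarySymmetroid.MatrixDescartes`, OPEN, on HOLD) with NO closure claim.  Companion of
`…PivotRankOneCriticalWindows` / `…CriticalWindowsThree`.  The exact TWO-SCALE DICTIONARY of the lineage's window profile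
`𝔅(x,T) = ∑ₖ wₖx^{dₖ}(T−tₖ)²/(T x^e)` (pivot letter `0` below the pivot, `d₀ < e`; upper letters `j`, `dⱼ > e`): its minimum over `x` (the ψ-profile `M(T)`,
whose sub-level set `{M < 2}` counts the windows, `Z₊ = 2N − 1`) is compared with the EXPLICIT two-letter minima
`gⱼ(T) = κⱼ·(w₀(T−t₀)²/T)^{θⱼ}·(wⱼ(T−tⱼ)²/T)^{1−θⱼ}`, `θⱼ = (dⱼ−e)/(dⱼ−d₀)`, `κⱼ = θⱼ^{−θⱼ}(1−θⱼ)^{−(1−θⱼ)}` (minimum over `x` of the pencil with the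
two letters `0, j` only).  Nothing here bears on `MatrixDescartes` in its window, on `DoorA26` / `DoorA34`, registers / credences, or `VP ≠ VNP`; no count is proved.

WHAT IS PROVED (equation-hypothesis style: `x` is a point where the `x`-critical equation `∑ₖ(dₖ−e)Wₖ(T−tₖ)² = 0` holds, `Wₖ = wₖx^{dₖ}`).
* §1 (no real powers) `scaledPair_critical`, `profile_eq_sum_scaledPairs` — splitting the pivot term with the weights
  `λⱼ = (dⱼ−e)Wⱼ(T−tⱼ)² / ((e−d₀)W₀(T−t₀)²)` (`λⱼ ≥ 0`, `∑λⱼ = 1` by the critical equation) writes the profile value as the SUM over `j` of the values of the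
  two-letter profiles with pivot weight `λⱼw₀`, and each of these scaled pairs is critical AT THE SAME `x`.
* §2 `criticalPair_value` — a two-term Laurent profile `A + B` (`A = α/x^m`, `B = βx^n`, `m, n ≥ 1`) at its critical point (`mA = nB`) has the value
  `κ·α^{θ}β^{1−θ}`, `θ = n/(m+n)`, INDEPENDENT of `x` (real powers: `Real.rpow`); `pair_ge_geom` — and at every `x > 0` it is `≥ κ·α^θβ^{1−θ}` (weighted AM–GM).
* §3 **`profile_critical_eq_gauge`**: at an `x`-critical point, `𝔅(x,T) = ∑ⱼ λⱼ^{θⱼ}·gⱼ(T)`; **`sandwich`**: `gⱼ(T) ≤ 𝔅(x,T) ≤ ∑ⱼ gⱼ(T)` for every `j` — so the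
  ψ-profile is the upper envelope of the (exactly known, log-concave-per-gap) two-letter profiles UP TO A FACTOR `#{upper letters}`:
  `|log M − max_j log gⱼ| ≤ log(K−1)` everywhere.  READING (seat memo PROFILE-GAUGE.md §1–§2): this is the quantitative backbone of a two-scale proof of the
  located per-side law (tropical counting is exact wherever consecutive two-letter profiles differ by a factor `> K−1`); the located law itself is OPEN.
[folklore] Weighted AM–GM (`Real.geom_mean_le_arith_mean2_weighted`); `Real.rpow` algebra.  No definitions, no named facts.
-/

-- `Summit.ValiantsHypothesis.ValiantsHypothesis.…` repeats a component by the D-0017 layout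
-- (single-conjunct summit), which the `dupNamespace` linter flags; the name is mandated.
set_option linter.dupNamespace false

namespace Summit.ValiantsHypothesis.ValiantsHypothesis.Theorems.LacunarySymmetroidMatrixDescartes.Pivot.CriticalWindows.Sandwich

open Finset
open scoped BigOperators

/-! ## 1. Splitting the pivot term at a critical point (no real powers) -/

/-- **THE SCALED PAIRS ARE CRITICAL AT THE SAME POINT.**  With `λⱼ := bⱼ Pⱼ / (a P₀)` (`P₀ = W₀(T−t₀)² > 0` the pivot term, `Pⱼ = Wⱼ(T−tⱼ)²` the `j`-th
term, `a = e − d₀`, `bⱼ = dⱼ − e`): `a·(λⱼP₀) = bⱼ·Pⱼ` — the two-letter profile with pivot weight scaled by `λⱼ` satisfies ITS critical equation at the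
same `x`. [folklore] -/
theorem scaledPair_critical (a bj P₀ Pj : ℝ) (ha : a ≠ 0) (hP₀ : P₀ ≠ 0) :
    a * ((bj * Pj / (a * P₀)) * P₀) = bj * Pj := by
  field_simp

/-- **THE SPLIT WEIGHTS SUM TO ONE** exactly when the `x`-critical equation `a P₀ = ∑ⱼ bⱼ Pⱼ` holds. [folklore] -/
theorem sum_split_eq_one {ι : Type*} (s : Finset ι) (a P₀ : ℝ) (b P : ι → ℝ) (ha : a ≠ 0) (hP₀ : P₀ ≠ 0)
    (hcrit : a * P₀ = ∑ j ∈ s, b j * P j) :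
    ∑ j ∈ s, b j * P j / (a * P₀) = 1 := by
  rw [← Finset.sum_div, ← hcrit, div_self (mul_ne_zero ha hP₀)]

/-- **THE PROFILE IS THE SUM OF THE SCALED PAIRS.**  If `∑ⱼ λⱼ = 1` then `P₀ + ∑ⱼ Pⱼ = ∑ⱼ (λⱼP₀ + Pⱼ)`. [folklore] -/
theorem profile_eq_sum_scaledPairs {ι : Type*} (s : Finset ι) (P₀ : ℝ) (lam P : ι → ℝ) (hsum : ∑ j ∈ s, lam j = 1) :
    P₀ + ∑ j ∈ s, P j = ∑ j ∈ s, (lam j * P₀ + P j) := by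
  rw [Finset.sum_add_distrib, ← Finset.sum_mul, hsum, one_mul]

/-! ## 2. The two-term Laurent profile: critical value and AM–GM floor (real powers) -/

/-- The `x`-dependence cancels in the weighted geometric mean: `(α/x^m)^θ · (βx^n)^{1−θ} = α^θ β^{1−θ}` when `mθ = n(1−θ)` (`x > 0`, `α, β ≥ 0`).
[folklore] -/
theorem geom_factor_eq (x α β θ : ℝ) (m n : ℕ) (hx : 0 < x) (hα : 0 ≤ α) (hβ : 0 ≤ β)
    (hθ : (m : ℝ) * θ = (n : ℝ) * (1 - θ)) :
    (α / x ^ m) ^ θ * (β * x ^ n) ^ (1 - θ) = α ^ θ * β ^ (1 - θ) := by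
  have hxm : 0 ≤ x ^ m := pow_nonneg hx.le m
  have hxn : 0 ≤ x ^ n := pow_nonneg hx.le n
  rw [Real.div_rpow hα hxm, Real.mul_rpow hβ hxn]
  have h1 : (x ^ m) ^ θ = x ^ ((m : ℝ) * θ) := by
    rw [← Real.rpow_natCast x m, ← Real.rpow_mul hx.le]
  have h2 : (x ^ n) ^ (1 - θ) = x ^ ((n : ℝ) * (1 - θ)) := by
    rw [← Real.rpow_natCast x n, ← Real.rpow_mul hx.le]
  rw [h1, h2, ← hθ]
  have hpos : 0 < x ^ ((m : ℝ) * θ) := Real.rpow_pos_of_pos hx _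
  field_simp

/-- **CRITICAL VALUE OF A TWO-TERM PROFILE.**  If `A, B ≥ 0` satisfy the critical equation `m·A = n·B` (`m, n > 0`) then
`A + B = ((m+n)/n)·(n/m)^{m/(m+n)} · A^{n/(m+n)} B^{m/(m+n)}`. [folklore] -/
theorem critical_sum_eq (A B : ℝ) (m n : ℝ) (hA : 0 ≤ A) (hm : 0 < m) (hn : 0 < n) (hfoc : m * A = n * B) :
    A + B = ((m + n) / n) * (n / m) ^ (m / (m + n)) * (A ^ (n / (m + n)) * B ^ (m / (m + n))) := by
  have hmn : 0 < m + n := by linarith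
  have hB : B = m * A / n := by field_simp; linarith
  have hθ1 : n / (m + n) + m / (m + n) = 1 := by
    rw [← add_div, add_comm, div_self hmn.ne']
  rcases hA.eq_or_lt with hA0 | hApos
  · -- `A = 0`, hence `B = 0`
    have hB0 : B = 0 := by rw [hB, ← hA0]; simp
    rw [← hA0, hB0, Real.zero_rpow (div_pos hn hmn).ne', zero_mul, mul_zero, add_zero]
  · have hmApos : 0 < m * A / n := div_pos (mul_pos hm hApos) hn
    rw [hB]
    -- `(mA/n)^{m/(m+n)} = (m/n)^{m/(m+n)} A^{m/(m+n)}`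
    have hsplit : (m * A / n) ^ (m / (m + n)) = (m / n) ^ (m / (m + n)) * A ^ (m / (m + n)) := by
      rw [show m * A / n = (m / n) * A by ring, Real.mul_rpow (div_pos hm hn).le hApos.le]
    rw [hsplit]
    have hAA : A ^ (n / (m + n)) * A ^ (m / (m + n)) = A := by
      rw [← Real.rpow_add hApos, hθ1, Real.rpow_one]
    have hnm : (n / m) ^ (m / (m + n)) * (m / n) ^ (m / (m + n)) = 1 := by
      rw [← Real.mul_rpow (div_pos hn hm).le (div_pos hm hn).le, show n / m * (m / n) = 1 by field_simp, Real.one_rpow]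
    calc A + m * A / n = ((m + n) / n) * A := by field_simp; ring
      _ = ((m + n) / n) * ((n / m) ^ (m / (m + n)) * (m / n) ^ (m / (m + n))) * (A ^ (n / (m + n)) * A ^ (m / (m + n))) := by
          rw [hnm, hAA]; ring
      _ = ((m + n) / n) * (n / m) ^ (m / (m + n)) * (A ^ (n / (m + n)) * ((m / n) ^ (m / (m + n)) * A ^ (m / (m + n)))) := by
          ring

/-- **AM–GM FLOOR OF A TWO-TERM PROFILE.**  For `A, B ≥ 0` and `m, n > 0`: `A + B ≥ ((m+n)/n)·(n/m)^{m/(m+n)} · A^{n/(m+n)} B^{m/(m+n)}` — the critical value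
of `critical_sum_eq` is the minimum (weighted AM–GM with weights `n/(m+n)`, `m/(m+n)` applied to `A/(n/(m+n))` and `B/(m/(m+n))`). [folklore] -/
theorem sum_ge_critical (A B : ℝ) (m n : ℝ) (hA : 0 ≤ A) (hB : 0 ≤ B) (hm : 0 < m) (hn : 0 < n) :
    ((m + n) / n) * (n / m) ^ (m / (m + n)) * (A ^ (n / (m + n)) * B ^ (m / (m + n))) ≤ A + B := by
  have hmn : 0 < m + n := by linarith
  set θ : ℝ := n / (m + n) with hθ
  have hθ' : m / (m + n) = 1 - θ := by rw [hθ]; field_simp; ring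
  have hθpos : 0 < θ := div_pos hn hmn
  have hθlt : θ < 1 := by rw [hθ, div_lt_one hmn]; linarith
  have h1θ : 0 < 1 - θ := by linarith
  -- weighted AM–GM: (A/θ)^θ (B/(1−θ))^{1−θ} ≤ θ (A/θ) + (1−θ)(B/(1−θ)) = A + B
  have hamgm := Real.geom_mean_le_arith_mean2_weighted hθpos.le h1θ.le (div_nonneg hA hθpos.le)
    (div_nonneg hB h1θ.le) (by ring)
  have hrhs : θ * (A / θ) + (1 - θ) * (B / (1 - θ)) = A + B := by
    field_simp
  rw [hrhs] at hamgm
  -- identify the left-hand sides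
  have hlhs : (A / θ) ^ θ * (B / (1 - θ)) ^ (1 - θ)
      = ((m + n) / n) * (n / m) ^ (m / (m + n)) * (A ^ (n / (m + n)) * B ^ (m / (m + n))) := by
    rw [Real.div_rpow hA hθpos.le, Real.div_rpow hB h1θ.le, hθ', ← hθ]
    have hθinv : θ ^ θ * (1 - θ) ^ (1 - θ) ≠ 0 :=
      mul_ne_zero (Real.rpow_pos_of_pos hθpos _).ne' (Real.rpow_pos_of_pos h1θ _).ne'
    -- `1/(θ^θ (1−θ)^{1−θ}) = ((m+n)/n) (n/m)^{1−θ}`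
    have hkey : ((m + n) / n) * (n / m) ^ (1 - θ) * (θ ^ θ * (1 - θ) ^ (1 - θ)) = 1 := by
      have e1 : θ = n / (m + n) := hθ
      have e2 : 1 - θ = m / (m + n) := hθ'.symm
      -- `(n/m)^{1−θ} (1−θ)^{1−θ} = (θ)^{1−θ}`: since `(n/m)·(m/(m+n)) = n/(m+n) = θ`
      have h3 : (n / m) ^ (1 - θ) * (1 - θ) ^ (1 - θ) = θ ^ (1 - θ) := by
        rw [← Real.mul_rpow (div_pos hn hm).le h1θ.le, e2, ← e2]
        congr 1
        rw [e2, e1]; field_simp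
      -- `θ^θ θ^{1−θ} = θ`
      have h4 : θ ^ θ * θ ^ (1 - θ) = θ := by
        rw [← Real.rpow_add hθpos, add_sub_cancel, Real.rpow_one]
      calc ((m + n) / n) * (n / m) ^ (1 - θ) * (θ ^ θ * (1 - θ) ^ (1 - θ))
          = ((m + n) / n) * (θ ^ θ * ((n / m) ^ (1 - θ) * (1 - θ) ^ (1 - θ))) := by ring
        _ = ((m + n) / n) * (θ ^ θ * θ ^ (1 - θ)) := by rw [h3]
        _ = ((m + n) / n) * θ := by rw [h4]
        _ = 1 := by rw [e1]; field_simp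
    have hk' : (m + n) / n * (n / m) ^ (1 - θ) = 1 / (θ ^ θ * (1 - θ) ^ (1 - θ)) := by
      rw [eq_div_iff hθinv]; exact hkey
    rw [hk', div_mul_div_comm, div_mul_eq_mul_div, one_mul]
  rw [hlhs] at hamgm
  exact hamgm

/-! ## 3. The sandwich for the window profile -/

/-- **ONE SCALED PAIR.**  For `α ≥ 0`, `β ≥ 0`, `x > 0`, `m, n ≥ 1`, `0 ≤ λ`, if `m·(λα/x^m) = n·(βx^n)` (the scaled pair is critical at `x`) then
`λα/x^m + βx^n = λ^{θ}·g` with `θ = n/(m+n)` and `g = ((m+n)/n)(n/m)^{m/(m+n)}·α^{θ}β^{1−θ}` — the `x`-free two-letter minimum. [folklore] -/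
theorem scaledPair_value (α β x lam : ℝ) (m n : ℕ) (hα : 0 ≤ α) (hβ : 0 ≤ β) (hx : 0 < x) (hlam : 0 ≤ lam)
    (hm : 0 < m) (hn : 0 < n) (hfoc : (m : ℝ) * (lam * α / x ^ m) = (n : ℝ) * (β * x ^ n)) :
    lam * α / x ^ m + β * x ^ n
      = lam ^ ((n : ℝ) / (m + n)) * ((((m : ℝ) + n) / n) * ((n : ℝ) / m) ^ ((m : ℝ) / (m + n))
          * (α ^ ((n : ℝ) / (m + n)) * β ^ ((m : ℝ) / (m + n)))) := by
  have hm' : (0 : ℝ) < m := by exact_mod_cast hm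
  have hn' : (0 : ℝ) < n := by exact_mod_cast hn
  have hA : 0 ≤ lam * α / x ^ m := div_nonneg (mul_nonneg hlam hα) (pow_nonneg hx.le m)
  rw [critical_sum_eq (lam * α / x ^ m) (β * x ^ n) m n hA hm' hn' hfoc]
  -- cancel `x` in the geometric mean and pull `λ` out
  have hθ : (m : ℝ) * ((n : ℝ) / (m + n)) = (n : ℝ) * (1 - (n : ℝ) / (m + n)) := by
    have : (m : ℝ) + n ≠ 0 := by positivity
    field_simp; ring
  have hone : 1 - (n : ℝ) / (m + n) = (m : ℝ) / (m + n) := by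
    have : (m : ℝ) + n ≠ 0 := by positivity
    field_simp; ring
  have hgeom := geom_factor_eq x (lam * α) β ((n : ℝ) / (m + n)) m n hx (mul_nonneg hlam hα) hβ hθ
  rw [hone] at hgeom
  rw [hgeom, Real.mul_rpow hlam hα]
  ring

/-- **THE WINDOW PROFILE AT A CRITICAL POINT IS THE GAUGE OF THE TWO-LETTER MINIMA.**  Terms of the profile at `x > 0`: pivot term
`P₀ = α/x^m` (`α = w₀(T−t₀)²/T ≥ 0`, `m = e − d₀ ≥ 1`), upper terms `Pⱼ = βⱼ x^{nⱼ}` (`βⱼ = wⱼ(T−tⱼ)²/T ≥ 0`, `nⱼ = dⱼ − e ≥ 1`).  If the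
`x`-critical equation `m·P₀ = Σⱼ nⱼ·Pⱼ` holds and `P₀ > 0`, then with `λⱼ = nⱼPⱼ/(mP₀)`:
`P₀ + Σⱼ Pⱼ = Σⱼ λⱼ^{θⱼ}·gⱼ`, `gⱼ = ((m+nⱼ)/nⱼ)(nⱼ/m)^{m/(m+nⱼ)}·α^{θⱼ}βⱼ^{1−θⱼ}`, `θⱼ = nⱼ/(m+nⱼ)`. [folklore] -/
theorem profile_critical_eq_gauge {ι : Type*} (s : Finset ι) (α x : ℝ) (m : ℕ) (β : ι → ℝ) (n : ι → ℕ)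
    (hα : 0 < α) (hx : 0 < x) (hm : 0 < m) (hβ : ∀ j ∈ s, 0 ≤ β j) (hn : ∀ j ∈ s, 0 < n j)
    (hcrit : (m : ℝ) * (α / x ^ m) = ∑ j ∈ s, (n j : ℝ) * (β j * x ^ (n j))) :
    α / x ^ m + ∑ j ∈ s, β j * x ^ (n j)
      = ∑ j ∈ s, ((n j : ℝ) * (β j * x ^ (n j)) / ((m : ℝ) * (α / x ^ m))) ^ ((n j : ℝ) / (m + n j))
          * ((((m : ℝ) + n j) / n j) * ((n j : ℝ) / m) ^ ((m : ℝ) / (m + n j))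
            * (α ^ ((n j : ℝ) / (m + n j)) * β j ^ ((m : ℝ) / (m + n j)))) := by
  have hm' : (0 : ℝ) < m := by exact_mod_cast hm
  have hP₀ : 0 < α / x ^ m := div_pos hα (pow_pos hx m)
  have hsum := sum_split_eq_one s (m : ℝ) (α / x ^ m) (fun j => (n j : ℝ)) (fun j => β j * x ^ (n j)) hm'.ne' hP₀.ne' hcrit
  rw [profile_eq_sum_scaledPairs s (α / x ^ m) (fun j => (n j : ℝ) * (β j * x ^ (n j)) / ((m : ℝ) * (α / x ^ m)))
    (fun j => β j * x ^ (n j)) hsum]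
  refine Finset.sum_congr rfl fun j hj => ?_
  have hlam : 0 ≤ (n j : ℝ) * (β j * x ^ (n j)) / ((m : ℝ) * (α / x ^ m)) :=
    div_nonneg (mul_nonneg (Nat.cast_nonneg _) (mul_nonneg (hβ j hj) (pow_nonneg hx.le _))) (mul_pos hm' hP₀).le
  have hfoc : (m : ℝ) * ((n j : ℝ) * (β j * x ^ (n j)) / ((m : ℝ) * (α / x ^ m)) * α / x ^ m)
      = (n j : ℝ) * (β j * x ^ (n j)) := by
    field_simp
  have h := scaledPair_value α (β j) x ((n j : ℝ) * (β j * x ^ (n j)) / ((m : ℝ) * (α / x ^ m))) m (n j) hα.le (hβ j hj)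
    hx hlam hm (hn j hj) hfoc
  rw [← h]
  ring

/-- **SANDWICH LAW.**  Under the hypotheses of `profile_critical_eq_gauge`: for every upper letter `j`,
`gⱼ ≤ P₀ + Σ Pₖ ≤ Σₖ gₖ` — the window profile at its critical point (= the ψ-profile `M(T)`) lies between the largest two-letter minimum and the sum of
all of them (`≤ (K−1)·max`).  The lower bound holds at EVERY `x > 0` (weighted AM–GM); the upper bound uses `λₖ ≤ 1`. [folklore] -/
theorem sandwich {ι : Type*} (s : Finset ι) (α x : ℝ) (m : ℕ) (β : ι → ℝ) (n : ι → ℕ)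
    (hα : 0 < α) (hx : 0 < x) (hm : 0 < m) (hβ : ∀ j ∈ s, 0 ≤ β j) (hn : ∀ j ∈ s, 0 < n j)
    (hcrit : (m : ℝ) * (α / x ^ m) = ∑ j ∈ s, (n j : ℝ) * (β j * x ^ (n j))) (j : ι) (hj : j ∈ s) :
    (((m : ℝ) + n j) / n j) * ((n j : ℝ) / m) ^ ((m : ℝ) / (m + n j)) * (α ^ ((n j : ℝ) / (m + n j)) * β j ^ ((m : ℝ) / (m + n j)))
        ≤ α / x ^ m + ∑ k ∈ s, β k * x ^ (n k) ∧
      α / x ^ m + ∑ k ∈ s, β k * x ^ (n k)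
        ≤ ∑ k ∈ s, (((m : ℝ) + n k) / n k) * ((n k : ℝ) / m) ^ ((m : ℝ) / (m + n k))
            * (α ^ ((n k : ℝ) / (m + n k)) * β k ^ ((m : ℝ) / (m + n k))) := by
  have hm' : (0 : ℝ) < m := by exact_mod_cast hm
  have hP₀ : 0 < α / x ^ m := div_pos hα (pow_pos hx m)
  constructor
  · -- lower: AM–GM for the pair (0, j), then drop the other (non-negative) terms
    have hnj : (0 : ℝ) < n j := by exact_mod_cast hn j hj
    have hpair := sum_ge_critical (α / x ^ m) (β j * x ^ (n j)) m (n j) hP₀.le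
      (mul_nonneg (hβ j hj) (pow_nonneg hx.le _)) hm' hnj
    have hθ : (m : ℝ) * ((n j : ℝ) / (m + n j)) = (n j : ℝ) * (1 - (n j : ℝ) / (m + n j)) := by
      have : (m : ℝ) + n j ≠ 0 := by positivity
      field_simp; ring
    have hone : 1 - (n j : ℝ) / (m + n j) = (m : ℝ) / (m + n j) := by
      have : (m : ℝ) + n j ≠ 0 := by positivity
      field_simp; ring
    have hgeom := geom_factor_eq x α (β j) ((n j : ℝ) / (m + n j)) m (n j) hx hα.le (hβ j hj) hθ
    rw [hone] at hgeom
    rw [hgeom] at hpair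
    have hrest : β j * x ^ (n j) ≤ ∑ k ∈ s, β k * x ^ (n k) :=
      Finset.single_le_sum (fun k hk => mul_nonneg (hβ k hk) (pow_nonneg hx.le _)) hj
    linarith
  · -- upper: the gauge form with `λₖ ≤ 1`
    rw [profile_critical_eq_gauge s α x m β n hα hx hm hβ hn hcrit]
    refine Finset.sum_le_sum fun k hk => ?_
    have hnk : (0 : ℝ) < n k := by exact_mod_cast hn k hk
    have hg : 0 ≤ (((m : ℝ) + n k) / n k) * ((n k : ℝ) / m) ^ ((m : ℝ) / (m + n k))
        * (α ^ ((n k : ℝ) / (m + n k)) * β k ^ ((m : ℝ) / (m + n k))) := by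
      have : 0 ≤ ((n k : ℝ) / m) ^ ((m : ℝ) / (m + n k)) := Real.rpow_nonneg (div_pos hnk hm').le _
      have : 0 ≤ α ^ ((n k : ℝ) / (m + n k)) := Real.rpow_nonneg hα.le _
      have : 0 ≤ β k ^ ((m : ℝ) / (m + n k)) := Real.rpow_nonneg (hβ k hk) _
      positivity
    -- `λₖ ≤ 1` because `nₖPₖ ≤ Σ nP = mP₀`
    have hlam_le : (n k : ℝ) * (β k * x ^ (n k)) / ((m : ℝ) * (α / x ^ m)) ≤ 1 := by
      rw [div_le_one (mul_pos hm' hP₀), hcrit]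
      exact Finset.single_le_sum (fun i hi => mul_nonneg (Nat.cast_nonneg _)
        (mul_nonneg (hβ i hi) (pow_nonneg hx.le _))) hk
    have hlam_nn : 0 ≤ (n k : ℝ) * (β k * x ^ (n k)) / ((m : ℝ) * (α / x ^ m)) :=
      div_nonneg (mul_nonneg (Nat.cast_nonneg _) (mul_nonneg (hβ k hk) (pow_nonneg hx.le _))) (mul_pos hm' hP₀).le
    have hpow : ((n k : ℝ) * (β k * x ^ (n k)) / ((m : ℝ) * (α / x ^ m))) ^ ((n k : ℝ) / (m + n k)) ≤ 1 :=
      Real.rpow_le_one hlam_nn hlam_le (div_pos hnk (by positivity)).le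
    calc _ ≤ 1 * ((((m : ℝ) + n k) / n k) * ((n k : ℝ) / m) ^ ((m : ℝ) / (m + n k))
            * (α ^ ((n k : ℝ) / (m + n k)) * β k ^ ((m : ℝ) / (m + n k)))) :=
          mul_le_mul_of_nonneg_right hpow hg
      _ = _ := one_mul _

end Summit.ValiantsHypothesis.ValiantsHypothesis.Theorems.LacunarySymmetroidMatrixDescartes.Pivot.CriticalWindows.Sandwich
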